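import Literature.AnabelianGeometry.SemiGraphs.TemperedExtensionCanonical

/-!
# Extensions of tempered groups, VI: in the split case the glued topology is the product topology
# ([SemiAnbd] Prop 5.2 (iv) p. 64 — correctness certificate for the construction)

Mochizuki, *Semi-graphs of anabelioids*, Publ. RIMS **42** (2006) 221–322, Prop 5.2 (iv) p. 64
[cite: MochizukiSemiAnbd2006, Prop 5.2 (iv), p. 64].

PROOF-ONLY certificate (row T54-B-top; seat abc-iut-L3-d2).  The tempered topology on an extension
`1 → Π → E → Π_A → 1` is glued (`TemperedExtensionTempered.exists_isTempered_topology_of_kernelSeq`)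
from a kernel sequence `K n` through the basis `{K n ⊓ aug⁻¹U}`.  In the one case where the answer is
known a priori — the DIRECT PRODUCT `E = Π × Π_A`, `ι = inl`, `aug = snd`, kernels `K n = N n × Π_A` for
an antitone basis `N n` of open normal subgroups of `Π` — the glued topology IS the product topology:

* `topology_eq_prod_of_kernelSeq_prod` — any group topology on `Π × Π_A` whose neighbourhood filter of
  `1` has basis `{(N n × ⊤) ⊓ snd⁻¹U}` equals the product topology (by
  `topology_eq_of_dominated_basis`: the product topology has basis `{N n × U}` at `1`).

So the engine reproduces the expected topology in the split case (complementing the non-vacuity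
certificate `ProfiniteSemiGraph.exists_arithTemperedGroup_split`).  Pure topological group theory, no
definitions.  Nothing here refers to the IUT corpus; no side is taken on any disputed claim.
-/

namespace Literature.AnabelianGeometry.SemiGraphs

namespace TemperedExtension

open Topology Filter

universe u v

variable {P : Type u} [Group P] [TopologicalSpace P] [IsTopologicalGroup P]
  {A : Type v} [Group A] [TopologicalSpace A] [IsTopologicalGroup A]

/-- **Split case = product topology**: on `Π × Π_A`, a group topology whose neighbourhoods of `1` have
basis `{(N n × ⊤) ⊓ snd⁻¹U : n, U ⊴ Π_A open}` for an antitone basis `N n` of open normal subgroups of `Π`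
(and `Π_A` with a basis of open normal subgroups at `1`, e.g. tempered) is the PRODUCT topology.
[cite: MochizukiSemiAnbd2006, Prop 5.2 (iv), p. 64] -/
theorem topology_eq_prod_of_kernelSeq_prod
    (N : ℕ → OpenNormalSubgroup P) (hN : (𝓝 (1 : P)).HasAntitoneBasis (fun n => (N n : Set P)))
    (hA : (𝓝 (1 : A)).HasBasis (fun _ : OpenNormalSubgroup A => True) (fun U => (U : Set A)))
    (τ : TopologicalSpace (P × A)) (hτ : @IsTopologicalGroup (P × A) τ _)
    (hb : (@nhds (P × A) τ 1).HasBasis (fun _ : ℕ × OpenNormalSubgroup A => True)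
      (fun nU => (((N nU.1).toSubgroup.prod ⊤ ⊓ nU.2.toSubgroup.comap (MonoidHom.snd P A) :
        Subgroup (P × A)) : Set (P × A)))) :
    τ = instTopologicalSpaceProd := by
  -- the product topology is a group topology with basis `{N n × U}` at `1`
  have hpg : @IsTopologicalGroup (P × A) instTopologicalSpaceProd _ := inferInstance
  have hprod : (@nhds (P × A) instTopologicalSpaceProd 1).HasBasis
      (fun _ : ℕ × OpenNormalSubgroup A => True)
      (fun nU => (((N nU.1).toSubgroup.prod nU.2.toSubgroup : Subgroup (P × A)) : Set (P × A))) := by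
    have h := hN.toHasBasis.prod hA
    rw [← nhds_prod_eq] at h
    refine ⟨fun S => ?_⟩
    rw [show (1 : P × A) = ((1 : P), (1 : A)) from rfl, h.mem_iff]
    constructor
    · rintro ⟨⟨n, U⟩, -, hS⟩
      exact ⟨(n, U), trivial, fun x hx => hS ⟨hx.1, hx.2⟩⟩
    · rintro ⟨⟨n, U⟩, -, hS⟩
      exact ⟨(n, U), ⟨trivial, trivial⟩, fun x hx => hS ⟨hx.1, hx.2⟩⟩
  refine topology_eq_of_dominated_basis (MonoidHom.snd P A) (fun n => (N n).toSubgroup.prod ⊤)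
    (fun nU : ℕ × OpenNormalSubgroup A => (N nU.1).toSubgroup.prod nU.2.toSubgroup) hτ hpg hb hprod
    (fun n U => ⟨(n, U), trivial, ?_⟩) (fun nU _ => ⟨nU.1, nU.2, ?_⟩)
  · rintro ⟨p, a⟩ ⟨hp, ha⟩
    exact ⟨⟨hp, trivial⟩, ha⟩
  · rintro ⟨p, a⟩ ⟨⟨hp, -⟩, ha⟩
    exact ⟨hp, ha⟩

end TemperedExtension

end Literature.AnabelianGeometry.SemiGraphs
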